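import Summits.BirchSwinnertonDyer.BirchSwinnertonDyer.Theorems.AlignedTransportAtTwoMainConjectureOfRankZeroBSDAtTwoCubicRankDoorLayerOne
import Summits.BirchSwinnertonDyer.BirchSwinnertonDyer.Theorems.ByReductionTypeAtTwoAnalyticMuZeroAtTwoHolds
import Literature.NumberTheory.IwasawaTheory.NarrowFukudaCertificateCompletenessCyclotomic
import Literature.NumberTheory.IwasawaTheory.ClassicalMuVanishesNormRelationTower
import Literature.NumberTheory.EllipticCurves.FineSelmerClassGroupPRankBoundedProofs
import HarnessLib

/-!
# Route `AlignedTransportAtTwo`, crux C2 `MainConjectureOfRankZeroBSDAtTwo` (stmt-22298), line `birth` — THE RANK-CERTIFICATE DOORS ARE SIGN-FREE AND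
# LOSSLESS: a NARROW rank rung of the cubic tower `ℚ(β)_j` (`j ≥ 1`) gives `MC₂(W)` for EITHER sign of `Δ_W`; per curve the plain rung is EQUIVALENT to
# H3M⁻ (`μ₂(ℚ(β)) = 0`) and the narrow rung to H3M⁺ (narrow `μ₂`-data); the even-branch analytic binder `hμan` is discharged

HONEST FRAMING (cell `bsd-f1-sign2`, WIDTH-5 attach seat `bsd-line-att-p4` g25; `--supports stmt-BirchSwinnertonDyer-22298 --as helper`).
THEOREMS ONLY (no `def`, no named fact, no `sorry`). BSD is NOT proved; C2 is NOT closed; its verdict «blocked-on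
`Rank1Residual.GreenbergMuConjectureIrreducible`» is untouched; every door below is CONDITIONAL on the displayed PRINT named facts, the registered stub
MuIneqʳ (verbatim) and the displayed per-curve certificate. No new mathematics: cell bsd-2adic's Literature theorems
(`Fukuda.classicalMuVanishes_iff_exists_classGroupPRank_succ_eq`, `NarrowFukuda.narrowMu_iff_exists_succ_eq_of_finrank_eq_three`, w2 GEN 9–11) wired into
this route's cubic-carrier road (att-p5 g24 `…CubicCarrierRoad`) and the layer-`≥ 1` rank door (att-p4 g24 `…CubicRankDoorLayerOne`).

WHY. After g24 the C2 input ledger read PRINT⁵ + MuIneqʳ + {`Δ_W < 0`: ONE plain 2-rank equality `rank₂ Cl(ℚ(β)_{n+1}) = rank₂ Cl(ℚ(β)_n)`, `n ≥ 1`, per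
curve} + {`0 < Δ_W`: H3M⁺ ∨ H6∃⁺, Iwasawa-theoretic ∀-statements along the whole tower}; REF1 §286: R286a «the certificate is exactly as strong as classical
`μ₂(ℚ(β)_∞) = 0`», R286c «the rank door is `Δ < 0` only». Both are answered in the kernel:

* §1 (any cubic number field `F`, every cyclotomic `ℤ₂`-extension `κ`; Fukuda index `≤ 1` is automatic, `forall_totallyRamifiedFrom_one_of_finrank_eq_three`):
  `μ₂(κ) = 0 ↔ ∃ n ≥ 1, rank₂ Cl(F_{n+1}) = rank₂ Cl(F_n)`; `rank₂ Cl(F_n)` is non-decreasing on `n ≥ 1` and frozen from the first stabilising pair on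
  (-data reading: compute `rank₂ Cl(F_1), rank₂ Cl(F_2), …` — the first repeated value certifies, no computed value is wasted); `∀ κ ∃ n ⟺ ∃ n ∀ κ`; the
  NARROW twin «H3M⁺-shape ⟺ some narrow rung `m ≥ 1`: `[Cl⁺(F_{m+1}) : (Cl⁺)²] = [Cl⁺(F_m) : (Cl⁺)²]` for every cyclotomic `κ`»; narrow rung ⟹ plain rung.
* §2 (per curve `W`, `E(ℚ)[2] = 0`, `β` a root of the `2`-division cubic): the same keyed to `ℚ(β)` — `forall_exists_classGroupPRank_succ_eq_iff_forall_classicalMu`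
  is R286a VERBATIM on the binders of g24's `hRank` (p754207) and of H3M⁻ (p751260); `exists_narrowRung_iff_narrowMuData` on the binders of H3M⁺ (p751260).
* §3 **THE NARROW RANK DOOR, BOTH SIGNS** `mazurMainConjecture_two_of_muIneqRel_of_narrowRung`: PRINT⁵ + MuIneqʳ + cell hypotheses (good ordinary at `2`,
  no rational `2`-torsion abscissa, `r_an = 0`, `BSD₂(W)`) + ONE rung `m ≥ 1` of NARROW 2-ranks of the cubic tower ⟹ `MC₂(W)` — NO sign condition, NO
  `Δ_min mod 8` condition, NO ramification bit, NO `hμan` binder (the tree theorem `AnalyticMuTwo.red_ne_zero_…`, bsd-2adic p641779 / att-p3 g10). On `0 < Δ_W`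
  this is the first per-curve FINITE certificate shape for C2 on this route (R286c; the narrow 2-ranks of two layers, what cell bsd-2adic k4's `narrowRankEq₁₂`
  rows compute); the **SIGN-SPLIT DOOR** `…_of_rankCert_signSplit` takes «plain rung if `Δ < 0`, narrow rung if `0 < Δ`», `hμan`-free.
* §4 the `hμan`-free forms of g24's rows `2045b1` / `1727a1`: displayed {`r_an = 0`, ONE 2-rank equality at layers `≥ 1`} beyond PRINT⁶ + MuIneqʳ.

PARTITION (D-0171): none moved (no certified seed has `0 < Δ`); the C2 number-field input is now UNIFORMLY «one finite 2-rank certificate per curve at layers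
`(m, m+1)`, `m ≥ 1`, of the cubic tower — plain on `Δ < 0`, narrow on `0 < Δ`», losing NOTHING against the `μ`-form (§2). Beyond-print theorem: no.

References: [Fukuda1994] Thm. 1 (2), p. 264; [Washington1997] §13.1 Lemma 13.3, §13.3 Prop. 13.22–13.23; [Kida1982JFields] (μ-part, shape);
[Iwasawa1973MuInvariants] Thm. 2/3; [Kato2004Asterisque] Thm. 17.4 (1)(2); [GreenbergLNM1716] Thm. 4.1, Conj. 1.11; [CreutzMiller2012] Thm. 1.1;
[CremonaAlgorithms1997] Table 1. BSD is NOT proved by any of this.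
-/

set_option linter.dupNamespace false
set_option autoImplicit false

noncomputable section

open scoped MatrixGroups ModularForm NumberField Classical
open CongruenceSubgroup WeierstrassCurve Polynomial NumberField Module Field
open Literature.NumberTheory.EllipticCurves Literature.NumberTheory.EllipticCurves.ModularForms
open Literature.NumberTheory.EllipticCurves.Greenberg1999 Literature.NumberTheory.EllipticCurves.Module
open Literature.NumberTheory.EllipticCurves.Rank1Residual Literature.NumberTheory.EllipticCurves.Rank1Residual.Typed
open Literature.NumberTheory.GaloisRepresentations Literature.NumberTheory.IwasawaTheory
open Literature.NumberTheory.NumberFields (narrowClassNumber NarrowClassGroup)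
open Literature.NumberTheory.EllipticCurves.CoatesSujatha2005 (classGroupPRank_eq_of_isCyclotomic)
open Summit.BirchSwinnertonDyer.Rank1Residual Summit.BirchSwinnertonDyer.Rank1Residual.F1Sign2
open Summit.BirchSwinnertonDyer.Rank1Residual.X1.MuLambda Summit.BirchSwinnertonDyer.Rank1Residual.X5
open Summit.BirchSwinnertonDyer.BirchSwinnertonDyer.Theorems.Rank1ResidualX1Defs
open Summit.BirchSwinnertonDyer.BirchSwinnertonDyer.Theses.AlignedTransportAtTwo
open Summit.BirchSwinnertonDyer.BirchSwinnertonDyer.Theorems.AlignedTransportAtTwoCubicCarrierRoad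
  (mazurMainConjecture_two_of_muIneqRel_of_narrowMu_cubicField)
open Summit.BirchSwinnertonDyer.BirchSwinnertonDyer.Theorems.AlignedTransportAtTwoCubicRankDoorLayerOne
  (mazurMainConjecture_two_of_muIneqRel_of_classGroupPRank_succ_eq_of_one_le)
open Summit.BirchSwinnertonDyer.BirchSwinnertonDyer.Theorems.TowerClass
open Summit.BirchSwinnertonDyer.BirchSwinnertonDyer.Theorems.AlignedTransportAtTwoOffStratumRow2045b
open Summit.BirchSwinnertonDyer.BirchSwinnertonDyer.Theorems.AlignedTransportAtTwoTwistFamilySmallSeeds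
open Summit.BirchSwinnertonDyer.BirchSwinnertonDyer.Theorems (AnalyticMuTwo.red_ne_zero_of_isEvenBranchLiftAtTwo_of_forall_not_hasRationalTwoTorsionX)

namespace Summit.BirchSwinnertonDyer.BirchSwinnertonDyer.Theorems.AlignedTransportAtTwoCubicNarrowRankDoor

/-! ## §1 Cubic number fields: the rank certificate is COMPLETE for `μ₂ = 0` from layer `1` on, both widths -/

section CubicField

variable {F : Type} [Field F] [NumberField F]

/-- **R286a at the number-field level.** For a cubic number field `F` and a cyclotomic `ℤ₂`-extension `κ` (Fukuda index `≤ 1` automatically):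
`μ₂(κ) = 0` (growth form) **iff** some pair of consecutive layers `F_n ⊂ F_{n+1}`, `n ≥ 1`, has the same `rank₂ Cl` — Fukuda Thm. 1 (2) (⟸) and rank
monotonicity + boundedness (⟹), both tree theorems. [cite: Fukuda1994, Thm. 1 (2), p. 264] [cite: Washington1997, §13.3 Prop. 13.22–13.23 and §13.1 Lemma 13.3] -/
theorem classicalMuVanishes_iff_exists_classGroupPRank_succ_eq_of_finrank_eq_three (h3 : Module.finrank ℚ F = 3)
    (κ : ZpExtension F 2) (hκ : κ.IsCyclotomic) :
    ClassicalMuVanishes κ ↔ ∃ n : ℕ, 1 ≤ n ∧ classGroupPRank κ (n + 1) = classGroupPRank κ n :=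
  Fukuda.classicalMuVanishes_iff_exists_classGroupPRank_succ_eq κ (forall_totallyRamifiedFrom_one_of_finrank_eq_three h3 κ hκ)

/-- **`rank₂ Cl(F_n)` is non-decreasing on `n ≥ 1`** along every cyclotomic `ℤ₂`-extension of a cubic field (norm surjectivity above Fukuda's index;
-data reading: a computed sequence of layer ranks can only go up, and the first repeat certifies). [cite: Washington1997, §13.3 Lemma 13.15]
[cite: Fukuda1994, Thm. 1 (2), p. 264 (proof)] -/
theorem classGroupPRank_mono_of_finrank_eq_three (h3 : Module.finrank ℚ F = 3) (κ : ZpExtension F 2) (hκ : κ.IsCyclotomic)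
    {n m : ℕ} (hn : 1 ≤ n) (hnm : n ≤ m) : classGroupPRank κ n ≤ classGroupPRank κ m :=
  Fukuda.classGroupPRank_mono κ (forall_totallyRamifiedFrom_one_of_finrank_eq_three h3 κ hκ) hn hnm

/-- **A stabilising pair freezes the rank**: `rank₂ Cl(F_{n+1}) = rank₂ Cl(F_n)` with `n ≥ 1` ⟹ `rank₂ Cl(F_m) = rank₂ Cl(F_n)` for all `m ≥ n`
(Fukuda Thm. 1 (2), first clause, index `1`). [cite: Fukuda1994, Thm. 1 (2), p. 264] -/
theorem classGroupPRank_eq_of_succ_eq_of_finrank_eq_three (h3 : Module.finrank ℚ F = 3) (κ : ZpExtension F 2) (hκ : κ.IsCyclotomic)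
    {n : ℕ} (hn : 1 ≤ n) (h : classGroupPRank κ (n + 1) = classGroupPRank κ n) {m : ℕ} (hm : n ≤ m) :
    classGroupPRank κ m = classGroupPRank κ n :=
  (fukuda1994_thm1_classGroupPRank_const_of_succ_eq_holds F 2 κ 1 (forall_totallyRamifiedFrom_one_of_finrank_eq_three h3 κ hκ) n hn h).1 m hm

omit [NumberField F] in
/-- **`∀ κ ∃ n ⟺ ∃ n ∀ κ` for the plain rung** (two cyclotomic `ℤ₂`-extensions of `F` have the same `rank₂ Cl` layer by layer,
`classGroupPRank_eq_of_isCyclotomic`; with no cyclotomic `κ` both sides hold). [cite: Washington1997, §13.1 (`K_∞` is independent of the normalisation)] -/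
theorem forall_exists_classGroupPRank_succ_eq_iff_exists_forall [NumberField F] :
    (∀ κ : ZpExtension F 2, κ.IsCyclotomic → ∃ n : ℕ, 1 ≤ n ∧ classGroupPRank κ (n + 1) = classGroupPRank κ n) ↔
      ∃ n : ℕ, 1 ≤ n ∧ ∀ κ : ZpExtension F 2, κ.IsCyclotomic → classGroupPRank κ (n + 1) = classGroupPRank κ n := by
  constructor
  · intro h
    by_cases hex : ∃ κ₀ : ZpExtension F 2, κ₀.IsCyclotomic
    · obtain ⟨κ₀, hκ₀⟩ := hex
      obtain ⟨n, hn, heq⟩ := h κ₀ hκ₀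
      refine ⟨n, hn, fun κ hκ => ?_⟩
      rw [classGroupPRank_eq_of_isCyclotomic κ κ₀ hκ hκ₀ (n + 1), classGroupPRank_eq_of_isCyclotomic κ κ₀ hκ hκ₀ n]
      exact heq
    · exact ⟨1, le_rfl, fun κ hκ => (hex ⟨κ, hκ⟩).elim⟩
  · rintro ⟨n, hn, h⟩ κ hκ
    exact ⟨n, hn, h κ hκ⟩

/-- **`∀ κ ∃ m ⟺ ∃ m ∀ κ` for the narrow rung** (cyclotomic `κ` share their narrow ranks layer by layer,
`index_range_pow_narrowClassGroup_layer_eq_of_isCyclotomic`, any `NumberField` instances). [cite: Washington1997, §13.1] -/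
theorem forall_exists_narrowRung_iff_exists_forall :
    (∀ κ : ZpExtension F 2, κ.IsCyclotomic → ∃ m : ℕ, 1 ≤ m ∧ ∀ [NumberField (κ.layer m)] [NumberField (κ.layer (m + 1))],
      (powMonoidHom (α := NarrowClassGroup (κ.layer (m + 1))) 2).range.index =
        (powMonoidHom (α := NarrowClassGroup (κ.layer m)) 2).range.index) ↔
      ∃ m : ℕ, 1 ≤ m ∧ ∀ κ : ZpExtension F 2, κ.IsCyclotomic → ∀ [NumberField (κ.layer m)] [NumberField (κ.layer (m + 1))],
        (powMonoidHom (α := NarrowClassGroup (κ.layer (m + 1))) 2).range.index =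
          (powMonoidHom (α := NarrowClassGroup (κ.layer m)) 2).range.index := by
  constructor
  · intro h
    by_cases hex : ∃ κ₀ : ZpExtension F 2, κ₀.IsCyclotomic
    · obtain ⟨κ₀, hκ₀⟩ := hex
      obtain ⟨m, hm, heq⟩ := h κ₀ hκ₀
      refine ⟨m, hm, fun κ hκ _ _ => ?_⟩
      haveI : FiniteDimensional F (κ₀.layer m) := κ₀.finiteDimensional_layer_holds m
      haveI : FiniteDimensional F (κ₀.layer (m + 1)) := κ₀.finiteDimensional_layer_holds (m + 1)
      haveI : NumberField (κ₀.layer m) := NumberField.of_module_finite F _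
      haveI : NumberField (κ₀.layer (m + 1)) := NumberField.of_module_finite F _
      rw [index_range_pow_narrowClassGroup_layer_eq_of_isCyclotomic κ₀ κ hκ₀ hκ (m + 1) 2,
        index_range_pow_narrowClassGroup_layer_eq_of_isCyclotomic κ₀ κ hκ₀ hκ m 2]
      exact heq
    · exact ⟨1, le_rfl, fun κ hκ => (hex ⟨κ, hκ⟩).elim⟩
  · rintro ⟨m, hm, h⟩ κ hκ
    exact ⟨m, hm, h κ hκ⟩

omit [NumberField F] in
/-- Reshuffle of the H3M⁺ binder shape (`∃ D, ∀ κ, μ = 0 ∧ bound`) into bsd-2adic's Kida-lite shape (`(∀ κ, μ = 0) ∧ ∃ D, ∀ κ, bound`). [folklore] -/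
theorem narrowMuData_iff [NumberField F] :
    (∃ D : ℕ, ∀ κ : ZpExtension F 2, κ.IsCyclotomic → ClassicalMuVanishes κ ∧ ∀ n : ℕ, ∀ [NumberField (κ.layer n)],
        padicValNat 2 (narrowClassNumber (κ.layer n)) ≤ padicValNat 2 (classNumber (κ.layer n)) + D) ↔
      ((∀ κ : ZpExtension F 2, κ.IsCyclotomic → ClassicalMuVanishes κ) ∧
        ∃ D : ℕ, ∀ κ : ZpExtension F 2, κ.IsCyclotomic → ∀ j : ℕ, ∀ [NumberField (κ.layer j)],
          padicValNat 2 (narrowClassNumber (κ.layer j)) ≤ padicValNat 2 (classNumber (κ.layer j)) + D) := by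
  constructor
  · rintro ⟨D, h⟩
    by_cases hex : ∃ κ₀ : ZpExtension F 2, κ₀.IsCyclotomic
    · exact ⟨fun κ hκ => (h κ hκ).1, D, fun κ hκ j _ => (h κ hκ).2 j⟩
    · exact ⟨fun κ hκ => (hex ⟨κ, hκ⟩).elim, D, fun κ hκ => (hex ⟨κ, hκ⟩).elim⟩
  · rintro ⟨hμ, D, hδ⟩
    exact ⟨D, fun κ hκ => ⟨hμ κ hκ, fun n _ => hδ κ hκ n⟩⟩

/-- **R286a's narrow twin at the number-field level.** For a cubic number field `F`: the H3M⁺-shaped narrow `μ₂`-data «`∃ D`, every cyclotomic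
`ℤ₂`-extension has `μ = 0` and `ord₂ h⁺(F_n) ≤ ord₂ h(F_n) + D` along its layers» **iff** some NARROW rung `m ≥ 1` fires:
`[Cl⁺(F_{m+1}) : Cl⁺(F_{m+1})²] = [Cl⁺(F_m) : Cl⁺(F_m)²]` for every cyclotomic `κ` (bsd-2adic w2 GEN 11). [cite: Fukuda1994, Thm. 1 (2), p. 264]
[cite: Washington1997, §13.3 Prop. 13.22–13.23] [cite: Kida1982JFields, main theorem (μ-part; shape only)] -/
theorem narrowMuData_iff_exists_narrowRung_of_finrank_eq_three (h3 : Module.finrank ℚ F = 3) :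
    (∃ D : ℕ, ∀ κ : ZpExtension F 2, κ.IsCyclotomic → ClassicalMuVanishes κ ∧ ∀ n : ℕ, ∀ [NumberField (κ.layer n)],
        padicValNat 2 (narrowClassNumber (κ.layer n)) ≤ padicValNat 2 (classNumber (κ.layer n)) + D) ↔
      ∃ m : ℕ, 1 ≤ m ∧ ∀ κ : ZpExtension F 2, κ.IsCyclotomic → ∀ [NumberField (κ.layer m)] [NumberField (κ.layer (m + 1))],
        (powMonoidHom (α := NarrowClassGroup (κ.layer (m + 1))) 2).range.index =
          (powMonoidHom (α := NarrowClassGroup (κ.layer m)) 2).range.index :=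
  narrowMuData_iff.trans (NarrowFukuda.narrowMu_iff_exists_succ_eq_of_finrank_eq_three F h3)

/-- **Narrow rung ⟹ plain rung** (cubic field): a narrow rung `m ≥ 1` gives `μ₂ = 0` for every cyclotomic `κ` (Kida-lite datum (a)), hence a plain
stabilising pair `n ≥ 1` by R286a. So the narrow certificate is a SIGN-FREE sufficient input wherever the plain one is. [cite: Fukuda1994, Thm. 1 (2), p. 264]
[cite: Washington1997, §13.3 Prop. 13.23] -/
theorem forall_exists_classGroupPRank_succ_eq_of_exists_narrowRung (h3 : Module.finrank ℚ F = 3)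
    (h : ∃ m : ℕ, 1 ≤ m ∧ ∀ κ : ZpExtension F 2, κ.IsCyclotomic → ∀ [NumberField (κ.layer m)] [NumberField (κ.layer (m + 1))],
      (powMonoidHom (α := NarrowClassGroup (κ.layer (m + 1))) 2).range.index =
        (powMonoidHom (α := NarrowClassGroup (κ.layer m)) 2).range.index) :
    ∀ κ : ZpExtension F 2, κ.IsCyclotomic → ∃ n : ℕ, 1 ≤ n ∧ classGroupPRank κ (n + 1) = classGroupPRank κ n := by
  obtain ⟨hμ, -⟩ := (NarrowFukuda.narrowMu_iff_exists_succ_eq_of_finrank_eq_three F h3).mpr h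
  exact fun κ hκ => (classicalMuVanishes_iff_exists_classGroupPRank_succ_eq_of_finrank_eq_three h3 κ hκ).mp (hμ κ hκ)

end CubicField

/-! ## §2 Per curve: the certificate binders of the route ledgers are EQUIVALENT to the `μ`-binders (R286a in the kernel) -/

section PerCurve

variable (W : WeierstrassCurve ℚ) [W.IsElliptic]

/-- `[ℚ(β) : ℚ] = 3` for a root `β` of the `2`-division cubic of a curve without rational `2`-torsion abscissa (k4-w3
`AddKatoTwo.finrank_adjoin_root_twoTorsionPolynomial_eq_three`). [cite: SilvermanAEC2009, III.§1 and VIII.§1] -/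
theorem finrank_adjoin_eq_three_of_forall_not_hasRationalTwoTorsionX (ht : ∀ x : ℚ, ¬ HasRationalTwoTorsionX W x)
    {β : AlgebraicClosure ℚ} (hβ : aeval β W.twoTorsionPolynomial.toPoly = 0) :
    Module.finrank ℚ ↥(IntermediateField.adjoin ℚ ({β} : Set (AlgebraicClosure ℚ))) = 3 :=
  AddKatoTwo.finrank_adjoin_root_twoTorsionPolynomial_eq_three W
    (AlignedTransportAtTwoSeed.irr_two_of_forall_not_hasRationalTwoTorsionX W ht) hβ

/-- **R286a IN THE KERNEL (per curve).** For `W/ℚ` without rational `2`-torsion abscissa and `β` a root of its `2`-division cubic: g24's certificate binder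
`hRank` «every cyclotomic `ℤ₂`-extension of `ℚ(β)` has a stabilising pair of 2-RANKS at some layers `(n, n+1)`, `n ≥ 1`» **iff** p751260's binder H3M⁻
«every cyclotomic `ℤ₂`-extension of `ℚ(β)` has `μ₂ = 0`». The 2-rank-certificate ledger (p754207) and the cubic-carrier ledger (p751260) have the SAME
`Δ < 0` input, curve by curve. [cite: Fukuda1994, Thm. 1 (2), p. 264] [cite: Washington1997, §13.3 Prop. 13.22–13.23] -/
theorem forall_exists_classGroupPRank_succ_eq_iff_forall_classicalMu (ht : ∀ x : ℚ, ¬ HasRationalTwoTorsionX W x)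
    {β : AlgebraicClosure ℚ} (hβ : aeval β W.twoTorsionPolynomial.toPoly = 0) :
    (∀ κP : ZpExtension ↥(IntermediateField.adjoin ℚ ({β} : Set (AlgebraicClosure ℚ))) 2, κP.IsCyclotomic →
        ∃ n : ℕ, 1 ≤ n ∧ classGroupPRank κP (n + 1) = classGroupPRank κP n) ↔
      ∀ κP : ZpExtension ↥(IntermediateField.adjoin ℚ ({β} : Set (AlgebraicClosure ℚ))) 2, κP.IsCyclotomic →
        ClassicalMuVanishes κP := by
  haveI : FiniteDimensional ℚ ↥(IntermediateField.adjoin ℚ ({β} : Set (AlgebraicClosure ℚ))) :=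
    IntermediateField.adjoin.finiteDimensional ((AlgebraicClosure.isAlgebraic ℚ).isAlgebraic β).isIntegral
  haveI : NumberField ↥(IntermediateField.adjoin ℚ ({β} : Set (AlgebraicClosure ℚ))) := NumberField.mk
  have h3 := finrank_adjoin_eq_three_of_forall_not_hasRationalTwoTorsionX W ht hβ
  exact forall₂_congr fun κP hκP => (classicalMuVanishes_iff_exists_classGroupPRank_succ_eq_of_finrank_eq_three h3 κP hκP).symm

/-- **R286a's narrow twin (per curve).** For `W/ℚ` without rational `2`-torsion abscissa and `β` a root of its `2`-division cubic: «some NARROW rung `m ≥ 1`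
fires for every cyclotomic `ℤ₂`-extension of `ℚ(β)`» **iff** p751260's binder H3M⁺ «`∃ D`, every cyclotomic `ℤ₂`-extension of `ℚ(β)` has `μ₂ = 0` and
`ord₂ h⁺(ℚ(β)_n) ≤ ord₂ h(ℚ(β)_n) + D`». [cite: Fukuda1994, Thm. 1 (2), p. 264] [cite: Washington1997, §13.3 Prop. 13.22–13.23]
[cite: Kida1982JFields, main theorem (μ-part; shape only)] -/
theorem exists_narrowRung_iff_narrowMuData (ht : ∀ x : ℚ, ¬ HasRationalTwoTorsionX W x)
    {β : AlgebraicClosure ℚ} (hβ : aeval β W.twoTorsionPolynomial.toPoly = 0) :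
    (∃ m : ℕ, 1 ≤ m ∧ ∀ κP : ZpExtension ↥(IntermediateField.adjoin ℚ ({β} : Set (AlgebraicClosure ℚ))) 2, κP.IsCyclotomic →
        ∀ [NumberField (κP.layer m)] [NumberField (κP.layer (m + 1))],
          (powMonoidHom (α := NarrowClassGroup (κP.layer (m + 1))) 2).range.index =
            (powMonoidHom (α := NarrowClassGroup (κP.layer m)) 2).range.index) ↔
      ∃ D : ℕ, ∀ κP : ZpExtension ↥(IntermediateField.adjoin ℚ ({β} : Set (AlgebraicClosure ℚ))) 2, κP.IsCyclotomic →
        ClassicalMuVanishes κP ∧ ∀ n : ℕ, ∀ [NumberField ↥(κP.layer n)],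
          padicValNat 2 (narrowClassNumber ↥(κP.layer n)) ≤ padicValNat 2 (classNumber ↥(κP.layer n)) + D := by
  haveI : FiniteDimensional ℚ ↥(IntermediateField.adjoin ℚ ({β} : Set (AlgebraicClosure ℚ))) :=
    IntermediateField.adjoin.finiteDimensional ((AlgebraicClosure.isAlgebraic ℚ).isAlgebraic β).isIntegral
  haveI : NumberField ↥(IntermediateField.adjoin ℚ ({β} : Set (AlgebraicClosure ℚ))) := NumberField.mk
  have h3 := finrank_adjoin_eq_three_of_forall_not_hasRationalTwoTorsionX W ht hβ
  exact (narrowMuData_iff_exists_narrowRung_of_finrank_eq_three h3).symm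

/-- **Narrow rung ⟹ plain rung, per curve** (so on `Δ_W < 0` a narrow certificate may be fed to g24's plain door). [cite: Fukuda1994, Thm. 1 (2), p. 264] -/
theorem forall_exists_classGroupPRank_succ_eq_of_exists_narrowRung_adjoin (ht : ∀ x : ℚ, ¬ HasRationalTwoTorsionX W x)
    {β : AlgebraicClosure ℚ} (hβ : aeval β W.twoTorsionPolynomial.toPoly = 0)
    (h : ∃ m : ℕ, 1 ≤ m ∧ ∀ κP : ZpExtension ↥(IntermediateField.adjoin ℚ ({β} : Set (AlgebraicClosure ℚ))) 2, κP.IsCyclotomic →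
        ∀ [NumberField (κP.layer m)] [NumberField (κP.layer (m + 1))],
          (powMonoidHom (α := NarrowClassGroup (κP.layer (m + 1))) 2).range.index =
            (powMonoidHom (α := NarrowClassGroup (κP.layer m)) 2).range.index) :
    ∀ κP : ZpExtension ↥(IntermediateField.adjoin ℚ ({β} : Set (AlgebraicClosure ℚ))) 2, κP.IsCyclotomic →
      ∃ n : ℕ, 1 ≤ n ∧ classGroupPRank κP (n + 1) = classGroupPRank κP n := by
  haveI : FiniteDimensional ℚ ↥(IntermediateField.adjoin ℚ ({β} : Set (AlgebraicClosure ℚ))) :=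
    IntermediateField.adjoin.finiteDimensional ((AlgebraicClosure.isAlgebraic ℚ).isAlgebraic β).isIntegral
  haveI : NumberField ↥(IntermediateField.adjoin ℚ ({β} : Set (AlgebraicClosure ℚ))) := NumberField.mk
  exact forall_exists_classGroupPRank_succ_eq_of_exists_narrowRung (finrank_adjoin_eq_three_of_forall_not_hasRationalTwoTorsionX W ht hβ) h

end PerCurve

/-! ## §3 THE NARROW RANK DOOR (both signs of `Δ_W`) and the SIGN-SPLIT door, `hμan`-free -/

section Doors

variable (W : WeierstrassCurve ℚ) [W.IsElliptic] [W.IsGloballyMinimal]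

/-- **THE NARROW RANK DOOR, BOTH SIGNS.** PRINT⁵ {Kato 17.4 (1)(2) at `2`, Greenberg 4.1, period unit, modularity, GZK} + MuIneqʳ (the registered stub
verbatim) + cell hypotheses (good ordinary at `2`, no rational `2`-torsion abscissa, `r_an = 0`, `BSD₂(W)`) + `β` a root of the `2`-division cubic + ONE rung
`m ≥ 1` of NARROW 2-ranks, `[Cl⁺(ℚ(β)_{m+1}) : (Cl⁺)²] = [Cl⁺(ℚ(β)_m) : (Cl⁺)²]` for every cyclotomic `ℤ₂`-extension of `ℚ(β)` ⟹ `MC₂(W)`. NO sign condition on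
`Δ_W`, no `Δ_min mod 8` condition, no ramification bit, no `hμan` binder (even-branch analytic `μ₂ = 0` is the tree theorem `AnalyticMuTwo.red_ne_zero_…`):
§2 turns the rung into the narrow `μ₂`-data of `ℚ(β)`, att-p5 g24's `…_of_narrowMu_cubicField` (Kida-lite ascent to `ℚ(β, √−1)`, PFμ⁶ road) concludes.
CONDITIONAL; nothing closed; BSD is NOT proved. [cite: Fukuda1994, Thm. 1 (2), p. 264] [cite: Kida1982JFields, main theorem (μ-part; shape only)]
[cite: Kato2004Asterisque, Thm. 17.4 (1)(2) (p. 273)] [cite: GreenbergLNM1716, Thm. 4.1 (p. 102) and Conj. 1.11 (p. 58)] -/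
theorem mazurMainConjecture_two_of_muIneqRel_of_narrowRung
    (h17 : ∀ [NeZero (W.conductorNorm ℤ)] (f : CuspForm (Gamma0 (W.conductorNorm ℤ)) 2),
      kato_divisibility_allPrimes W 2 (f := f))
    (hGr : Greenberg1999.thm41_charValue_rankZero_anyPrime)
    (hper : realPeriodRat_eq_unit_mul_plusPeriod_two) (hmod : nonempty_modularParametrizationData)
    (hGZK : rank_eq_analyticRank_of_analyticRank_le_one)
    (hI : ∀ (W : WeierstrassCurve ℚ) [W.IsElliptic] [W.IsGloballyMinimal], IsOrdinaryAt W 2 →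
      (∀ x : ℚ, ¬ HasRationalTwoTorsionX W x) →
      ∀ (κ : ZpExtension ℚ 2) (γ : Field.absoluteGaloisGroup ℚ), κ.IsCyclotomic →
      κ.IsTopGenerator γ → IsCyclotomicVariable 2 γ →
      ∀ ⦃N : ℕ⦄ [NeZero N] (f : CuspForm (Gamma0 N) 2), IsNewformOf W f →
      ∀ Gp : IwasawaAlgebra 2, iwasawaToPowerSeries 2 Gp = padicLFunction f (unitRoot W 2 : ℚ_[2]) →
      ∀ (D : W.SelmerDualData κ γ) (Yr : W.FineSelmerDualDataRelaxedInf κ γ),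
        lengthAt (IwasawaAlgebra 2) D.X ⟨IwasawaAlgebra.augIdealP 2, IwasawaAlgebra.isPrime_augIdealP_holds 2⟩ ≤
          lengthAt (IwasawaAlgebra 2) (IwasawaAlgebra 2 ⧸ Ideal.span {Gp})
              ⟨IwasawaAlgebra.augIdealP 2, IwasawaAlgebra.isPrime_augIdealP_holds 2⟩ +
            lengthAt (IwasawaAlgebra 2) Yr.X ⟨IwasawaAlgebra.augIdealP 2, IwasawaAlgebra.isPrime_augIdealP_holds 2⟩)
    (hord : IsOrdinaryAt W 2) (ht : ∀ x : ℚ, ¬ HasRationalTwoTorsionX W x) (hr : W.analyticRank = 0) (hbsd : BSDp W 2)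
    {β : AlgebraicClosure ℚ} (hβ : aeval β W.twoTorsionPolynomial.toPoly = 0)
    (hcert : ∃ m : ℕ, 1 ≤ m ∧ ∀ κP : ZpExtension ↥(IntermediateField.adjoin ℚ ({β} : Set (AlgebraicClosure ℚ))) 2, κP.IsCyclotomic →
      ∀ [NumberField (κP.layer m)] [NumberField (κP.layer (m + 1))],
        (powMonoidHom (α := NarrowClassGroup (κP.layer (m + 1))) 2).range.index =
          (powMonoidHom (α := NarrowClassGroup (κP.layer m)) 2).range.index) :
    MazurMainConjecture W 2 := by
  obtain ⟨D, hD⟩ := (exists_narrowRung_iff_narrowMuData W ht hβ).mp hcert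
  exact mazurMainConjecture_two_of_muIneqRel_of_narrowMu_cubicField W h17 hGr hper hmod hGZK hI hord ht hr
    (AnalyticMuTwo.red_ne_zero_of_isEvenBranchLiftAtTwo_of_forall_not_hasRationalTwoTorsionX W hord ht) hbsd hβ
    (fun κP hκP => (hD κP hκP).1) D (fun κP hκP n _ => (hD κP hκP).2 n)

/-- **THE SIGN-SPLIT DOOR, `hμan`-free.** PRINT⁵ + MuIneqʳ + cell hypotheses + `β` + «if `Δ_W < 0`: a PLAIN stabilising pair of 2-ranks `n ≥ 1` for every
cyclotomic `ℤ₂`-extension of `ℚ(β)` (g24's door); if `0 < Δ_W`: a NARROW rung `m ≥ 1`» ⟹ `MC₂(W)`. One finite 2-rank certificate per curve, either sign.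
CONDITIONAL; nothing closed; BSD is NOT proved. [cite: Fukuda1994, Thm. 1 (2), p. 264] [cite: Kato2004Asterisque, Thm. 17.4 (1)(2) (p. 273)]
[cite: GreenbergLNM1716, Thm. 4.1 (p. 102) and Conj. 1.11 (p. 58)] [cite: Kida1982JFields, main theorem (μ-part; shape only)] -/
theorem mazurMainConjecture_two_of_muIneqRel_of_rankCert_signSplit
    (h17 : ∀ [NeZero (W.conductorNorm ℤ)] (f : CuspForm (Gamma0 (W.conductorNorm ℤ)) 2),
      kato_divisibility_allPrimes W 2 (f := f))
    (hGr : Greenberg1999.thm41_charValue_rankZero_anyPrime)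
    (hper : realPeriodRat_eq_unit_mul_plusPeriod_two) (hmod : nonempty_modularParametrizationData)
    (hGZK : rank_eq_analyticRank_of_analyticRank_le_one)
    (hI : ∀ (W : WeierstrassCurve ℚ) [W.IsElliptic] [W.IsGloballyMinimal], IsOrdinaryAt W 2 →
      (∀ x : ℚ, ¬ HasRationalTwoTorsionX W x) →
      ∀ (κ : ZpExtension ℚ 2) (γ : Field.absoluteGaloisGroup ℚ), κ.IsCyclotomic →
      κ.IsTopGenerator γ → IsCyclotomicVariable 2 γ →
      ∀ ⦃N : ℕ⦄ [NeZero N] (f : CuspForm (Gamma0 N) 2), IsNewformOf W f →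
      ∀ Gp : IwasawaAlgebra 2, iwasawaToPowerSeries 2 Gp = padicLFunction f (unitRoot W 2 : ℚ_[2]) →
      ∀ (D : W.SelmerDualData κ γ) (Yr : W.FineSelmerDualDataRelaxedInf κ γ),
        lengthAt (IwasawaAlgebra 2) D.X ⟨IwasawaAlgebra.augIdealP 2, IwasawaAlgebra.isPrime_augIdealP_holds 2⟩ ≤
          lengthAt (IwasawaAlgebra 2) (IwasawaAlgebra 2 ⧸ Ideal.span {Gp})
              ⟨IwasawaAlgebra.augIdealP 2, IwasawaAlgebra.isPrime_augIdealP_holds 2⟩ +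
            lengthAt (IwasawaAlgebra 2) Yr.X ⟨IwasawaAlgebra.augIdealP 2, IwasawaAlgebra.isPrime_augIdealP_holds 2⟩)
    (hord : IsOrdinaryAt W 2) (ht : ∀ x : ℚ, ¬ HasRationalTwoTorsionX W x) (hr : W.analyticRank = 0) (hbsd : BSDp W 2)
    {β : AlgebraicClosure ℚ} (hβ : aeval β W.twoTorsionPolynomial.toPoly = 0)
    (hneg : W.Δ < 0 → ∀ κP : ZpExtension ↥(IntermediateField.adjoin ℚ ({β} : Set (AlgebraicClosure ℚ))) 2, κP.IsCyclotomic →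
      ∃ n : ℕ, 1 ≤ n ∧ classGroupPRank κP (n + 1) = classGroupPRank κP n)
    (hpos : 0 < W.Δ → ∃ m : ℕ, 1 ≤ m ∧
      ∀ κP : ZpExtension ↥(IntermediateField.adjoin ℚ ({β} : Set (AlgebraicClosure ℚ))) 2, κP.IsCyclotomic →
        ∀ [NumberField (κP.layer m)] [NumberField (κP.layer (m + 1))],
          (powMonoidHom (α := NarrowClassGroup (κP.layer (m + 1))) 2).range.index =
            (powMonoidHom (α := NarrowClassGroup (κP.layer m)) 2).range.index) :
    MazurMainConjecture W 2 := by
  rcases lt_or_gt_of_ne W.isUnit_Δ.ne_zero with hΔ | hΔ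
  · exact mazurMainConjecture_two_of_muIneqRel_of_classGroupPRank_succ_eq_of_one_le W h17 hGr hper hmod hGZK hI hord ht hΔ hr
      (AnalyticMuTwo.red_ne_zero_of_isEvenBranchLiftAtTwo_of_forall_not_hasRationalTwoTorsionX W hord ht) hbsd hβ (hneg hΔ)
  · exact mazurMainConjecture_two_of_muIneqRel_of_narrowRung W h17 hGr hper hmod hGZK hI hord ht hr hbsd hβ (hpos hΔ)

end Doors

/-! ## §4 The `hμan`-free rows at the certified seeds `2045b1` (off the stratum) and `1727a1` (Kilford) -/

/-- **ROW `2045b1`, `hμan`-free**: PRINT⁵ + Creutz–Miller (`N = 2045 < 5000`) + MuIneqʳ + displayed {`r_an(2045b1) = 0`, ONE plain 2-rank equality at layers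
`(n, n+1)`, `n ≥ 1`, per cyclotomic `ℤ₂`-extension of `ℚ(β)`} ⟹ `MC₂(2045b1)` — g24's row with its even-branch analytic binder discharged by the tree theorem
`AnalyticMuTwo.red_ne_zero_…` (good ordinary at `2`, no rational `2`-torsion abscissa: kernel facts of g21). CONDITIONAL; BSD is NOT proved.
[cite: Fukuda1994, Thm. 1 (2), p. 264] [cite: CreutzMiller2012, Thm. 1.1] [cite: Kato2004Asterisque, Thm. 17.4 (1)(2) (p. 273)] -/
theorem mazurMainConjecture_two_2045b1_of_rankCert_muFree
    (h17 : ∀ [NeZero (c2045b1.conductorNorm ℤ)] (f : CuspForm (Gamma0 (c2045b1.conductorNorm ℤ)) 2),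
      kato_divisibility_allPrimes c2045b1 2 (f := f))
    (hGr : Greenberg1999.thm41_charValue_rankZero_anyPrime)
    (hper : realPeriodRat_eq_unit_mul_plusPeriod_two) (hmod : nonempty_modularParametrizationData)
    (hGZK : rank_eq_analyticRank_of_analyticRank_le_one) (hCM : bsdTriple_of_rank_le_one_of_conductor_lt)
    (hI : ∀ (W : WeierstrassCurve ℚ) [W.IsElliptic] [W.IsGloballyMinimal], IsOrdinaryAt W 2 →
      (∀ x : ℚ, ¬ HasRationalTwoTorsionX W x) →
      ∀ (κ : ZpExtension ℚ 2) (γ : Field.absoluteGaloisGroup ℚ), κ.IsCyclotomic →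
      κ.IsTopGenerator γ → IsCyclotomicVariable 2 γ →
      ∀ ⦃N : ℕ⦄ [NeZero N] (f : CuspForm (Gamma0 N) 2), IsNewformOf W f →
      ∀ Gp : IwasawaAlgebra 2, iwasawaToPowerSeries 2 Gp = padicLFunction f (unitRoot W 2 : ℚ_[2]) →
      ∀ (D : W.SelmerDualData κ γ) (Yr : W.FineSelmerDualDataRelaxedInf κ γ),
        lengthAt (IwasawaAlgebra 2) D.X ⟨IwasawaAlgebra.augIdealP 2, IwasawaAlgebra.isPrime_augIdealP_holds 2⟩ ≤
          lengthAt (IwasawaAlgebra 2) (IwasawaAlgebra 2 ⧸ Ideal.span {Gp})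
              ⟨IwasawaAlgebra.augIdealP 2, IwasawaAlgebra.isPrime_augIdealP_holds 2⟩ +
            lengthAt (IwasawaAlgebra 2) Yr.X ⟨IwasawaAlgebra.augIdealP 2, IwasawaAlgebra.isPrime_augIdealP_holds 2⟩)
    (hr0 : c2045b1.analyticRank = 0)
    {β : AlgebraicClosure ℚ} (hβ : aeval β c2045b1.twoTorsionPolynomial.toPoly = 0)
    (hcert : ∀ κP : ZpExtension ↥(IntermediateField.adjoin ℚ ({β} : Set (AlgebraicClosure ℚ))) 2, κP.IsCyclotomic →
      ∃ n : ℕ, 1 ≤ n ∧ classGroupPRank κP (n + 1) = classGroupPRank κP n) :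
    MazurMainConjecture c2045b1 2 :=
  mazurMainConjecture_two_of_muIneqRel_of_classGroupPRank_succ_eq_of_one_le c2045b1 h17 hGr hper hmod hGZK hI
    goodOrd_two_2045b1 not_hasRationalTwoTorsionX_2045b1 Δ_2045b1_neg hr0
    (AnalyticMuTwo.red_ne_zero_of_isEvenBranchLiftAtTwo_of_forall_not_hasRationalTwoTorsionX c2045b1 goodOrd_two_2045b1
      not_hasRationalTwoTorsionX_2045b1)
    (bsdp_two_2045b1_of_creutzMiller hCM hGZK hr0) hβ hcert

/-- **ROW `1727a1`, `hμan`-free**: PRINT⁵ + Creutz–Miller + MuIneqʳ + displayed {`r_an(1727a1) = 0`, the layer-`(1,2)` 2-rank equality of every cyclotomic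
`ℤ₂`-extension of `ℚ(β)` (numerically `2 = 2`, bsd-2adic kit j300990)} ⟹ `MC₂(1727a1)`. CONDITIONAL; BSD is NOT proved. [cite: Fukuda1994, Thm. 1 (2), p. 264]
[cite: CreutzMiller2012, Thm. 1.1] [cite: Kato2004Asterisque, Thm. 17.4 (1)(2) (p. 273)] -/
theorem mazurMainConjecture_two_1727a1_of_rankCert_layerOne_muFree
    (h17 : ∀ [NeZero (c1727a1.conductorNorm ℤ)] (f : CuspForm (Gamma0 (c1727a1.conductorNorm ℤ)) 2),
      kato_divisibility_allPrimes c1727a1 2 (f := f))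
    (hGr : Greenberg1999.thm41_charValue_rankZero_anyPrime)
    (hper : realPeriodRat_eq_unit_mul_plusPeriod_two) (hmod : nonempty_modularParametrizationData)
    (hGZK : rank_eq_analyticRank_of_analyticRank_le_one) (hCM : bsdTriple_of_rank_le_one_of_conductor_lt)
    (hI : ∀ (W : WeierstrassCurve ℚ) [W.IsElliptic] [W.IsGloballyMinimal], IsOrdinaryAt W 2 →
      (∀ x : ℚ, ¬ HasRationalTwoTorsionX W x) →
      ∀ (κ : ZpExtension ℚ 2) (γ : Field.absoluteGaloisGroup ℚ), κ.IsCyclotomic →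
      κ.IsTopGenerator γ → IsCyclotomicVariable 2 γ →
      ∀ ⦃N : ℕ⦄ [NeZero N] (f : CuspForm (Gamma0 N) 2), IsNewformOf W f →
      ∀ Gp : IwasawaAlgebra 2, iwasawaToPowerSeries 2 Gp = padicLFunction f (unitRoot W 2 : ℚ_[2]) →
      ∀ (D : W.SelmerDualData κ γ) (Yr : W.FineSelmerDualDataRelaxedInf κ γ),
        lengthAt (IwasawaAlgebra 2) D.X ⟨IwasawaAlgebra.augIdealP 2, IwasawaAlgebra.isPrime_augIdealP_holds 2⟩ ≤
          lengthAt (IwasawaAlgebra 2) (IwasawaAlgebra 2 ⧸ Ideal.span {Gp})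
              ⟨IwasawaAlgebra.augIdealP 2, IwasawaAlgebra.isPrime_augIdealP_holds 2⟩ +
            lengthAt (IwasawaAlgebra 2) Yr.X ⟨IwasawaAlgebra.augIdealP 2, IwasawaAlgebra.isPrime_augIdealP_holds 2⟩)
    (hr0 : c1727a1.analyticRank = 0)
    {β : AlgebraicClosure ℚ} (hβ : aeval β c1727a1.twoTorsionPolynomial.toPoly = 0)
    (hrank : ∀ κP : ZpExtension ↥(IntermediateField.adjoin ℚ ({β} : Set (AlgebraicClosure ℚ))) 2, κP.IsCyclotomic →
      classGroupPRank κP 2 = classGroupPRank κP 1) :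
    MazurMainConjecture c1727a1 2 :=
  mazurMainConjecture_two_of_muIneqRel_of_classGroupPRank_succ_eq_of_one_le c1727a1 h17 hGr hper hmod hGZK hI
    goodOrd_two_1727a1 not_hasRationalTwoTorsionX_1727a1 Δ_1727a1_neg' hr0
    (AnalyticMuTwo.red_ne_zero_of_isEvenBranchLiftAtTwo_of_forall_not_hasRationalTwoTorsionX c1727a1 goodOrd_two_1727a1
      not_hasRationalTwoTorsionX_1727a1)
    (bsdp_two_1727a1_of_creutzMiller hCM hGZK hr0) hβ fun κP hκP => ⟨1, le_rfl, hrank κP hκP⟩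

end Summit.BirchSwinnertonDyer.BirchSwinnertonDyer.Theorems.AlignedTransportAtTwoCubicNarrowRankDoor

end
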